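import Mathlib
import HarnessLib
import Summits.Ventures.LatticeQCDFlow.TrivializingMaps.TheoremA
import Summits.Ventures.LatticeQCDFlow.TrivializingMaps.LoopActionPolynomials

/-!
HONEST FRAMING: exact (Metropolis-corrected) sampling algorithms for lattice gauge theory; figures of
merit are autocorrelation/cost numbers at stated couplings and volumes; no continuum-physics claim.
Statements about Lüscher's gradient series on finite periodic lattices, with constants that do not
depend on the lattice size; no continuum claim and no sampler claim.

# Volume-uniform exponential locality of the trivializing-flow generator series
# (cell pub-lqcd, theory-1 GEN-13; OURS — THEORY-1.md §12.5 C2)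

Lüscher, §4.5(b): "The series (4.11) is an expansion in local terms whose footprint on the lattice
increases proportionally to the order k. At the values of t, where the expansion converges, the action
S̃_t is then guaranteed to be local as well." — and, on a volume-uniform radius, "An analysis that takes
the locality properties of 𝓛 into account will however be required to show this."  THEOREM A is now a
tree theorem (`GradedSeries.luscherGeometricGradientBound_holds`: `|∂^a_e S̃_W^{(k)}(ιU)| ≤ C ρ^{-k}` with
`ρ, C` independent of the lattice size).  This file kernel-checks the LOCALITY corollary C2 of THEORY-1
§12.5 for the GENERATOR SERIES `g_t(U)^a_e := ∑_k t^k ∂^a_e S̃^{(k)}(ιU)` of ANY smooth solution `S̃^{(k)}`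
of Lüscher's recursion (4.12)–(4.13) for the action `β S_W` on `SU(n)^E`, `E` the links of `(ℤ/L)^d`:

* §1 `coeConfig_eqOn` — the plaquette-ball geometry (`linkBall_mono`, the triangle inequality
  `linkBall_add`) is the tree's `LoopActionPolynomials.lean` §1.
* §2 FOOTPRINT (C2(a)). `linkDeriv_wilsonSk_dependsOn`: `∂_{e,X} S̃_W^{(k)}` of the tree's constructed
  series depends only on the links in `linkBall (2(k+1)) e` (each anchored piece `G^{(k)}_{e₀} = anchTerm`
  lives on `linkBall (k+1) e₀`, `anchTerm_mem`, and contributes at `e` only if `e` is in that ball).  By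
  uniqueness of gradients (`IsLuscherSeries.linkDeriv_eq`) the same holds ON THE FIELD MANIFOLD for EVERY
  smooth solution for `β S_W`: `U, U' ∈ SU(n)^E` agreeing on `linkBall (2(k+1)) e` have equal
  `∂^a_e S̃^{(k)}` (`linkDeriv_series_local`); the order-`N` generator `-∂S̃^{[N]}_t` of the analytic
  samplers (`Truncation.lean`) is STRICTLY local with radius `2(N+1)` (`linkGrad_truncFlowAction_local`).
* §3 GEOMETRIC CONTROL AT EVERY COUPLING. `seriesGradient_geometric`:
  `|∂^a_e S̃^{(k)}(ιU)| ≤ C |β|^{k+1} ρ^{-k}` for every smooth solution for `β S_W` and every `L`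
  (Theorem A and the coupling scaling `IsLuscherSeries.smul`).
* §4 THE GENERATOR SERIES (C2(b), series side). `generatorSeries_tail_le`: for `0 < η ≤ 1` and
  `|t|·|β| ≤ (1-η) ρ` the series `g_t(U)^a_e` converges absolutely and
  `|g_t(U)^a_e - ∑_{k≤K} t^k ∂^a_e S̃^{(k)}(ιU)| ≤ C|β|(1-η)^{K+1}/η` for every `U, e, a, K` and EVERY
  `L`; the sum does not depend on the solution (`generatorSeries_eq_of_isLuscherSeries`).
* §5 EXPONENTIAL LOCALITY, UNIFORMLY IN THE VOLUME (C2). `generatorSeries_exponentially_local`: under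
  the same hypotheses, `U, U' ∈ SU(n)^E` agreeing on `linkBall (2(K+1)) e` have
  `|g_t(U)^a_e - g_t(U')^a_e| ≤ 2C|β|(1-η)^{K+1}/η` — the generator at a link is determined to precision
  `ε` by the link variables within plaquette-distance `2(K+1)`, `K = ⌈log(2C|β|/(ηε)) / log(1/(1-η))⌉`,
  with `ρ, C` depending on `d, n` only.  For `|β| ≤ (1-η)ρ` this covers the whole flow interval
  `t ∈ [-1, 1]`.

NOT claimed here (paper / cited only): the identification of `g_t` with the gradient `∂^a_e S̃_t` of
Lüscher's smooth flow action (THEORY-1 §12.5 C2(b1)/(b2); App. E's finite-volume convergence is the cited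
Literature `Prop` `SeriesConvergesFiniteVolume`), the infinite-lattice generator C2(c), and anything at
`|t|·|β| ≥ ρ`.  The radius `2(k+1)` is the crude one given by the anchored supports; THEORY-1 §12.5
C2(a) states plaquette-distance `k` on paper.

References: M. Lüscher, Commun. Math. Phys. 293 (2010) 899–919 [Luscher2010Trivializing,
arXiv:0907.5491], §4.3 eqs. (4.11)–(4.15), §4.5(b); THEORY-1.md §12.5 C2; AbelianTail.lean (the U(1)
majorant version of §4).  Tags: [ours] = venture bookkeeping.
-/

noncomputable section

namespace Summit.Ventures.LatticeQCDFlow.TrivializingMaps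

open Literature.MathematicalPhysics.QuantumFieldTheory
open Literature.MathematicalPhysics.QuantumFieldTheory.Luscher2010
open scoped Matrix Matrix.Norms.Frobenius ContDiff

variable {d L n : ℕ}

/-! ## §1. Configurations agreeing on a plaquette ball

The geometry of plaquette balls (`linkBall_mono`, the triangle inequality `linkBall_add`) is the
tree's `LoopActionPolynomials.lean` §1. -/

section Balls

/-- Group-valued configurations agreeing on a set of links have ambient representatives agreeing
there. [folklore] -/
theorem coeConfig_eqOn {U U' : GaugeConfig d L (Matrix.specialUnitaryGroup (Fin n) ℂ)}
    {A : Set (Edge d L)} (h : ∀ e' ∈ A, U e' = U' e') :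
    ∀ e' ∈ A, WilsonFlow.coeConfig U e' = WilsonFlow.coeConfig U' e' :=
  fun e' he' => by rw [WilsonFlow.coeConfig_apply, WilsonFlow.coeConfig_apply, h e' he']

end Balls

/-! ## §2. Footprint of the order-`k` gradient (C2(a)) -/

section Footprint

variable [NeZero L]

/-- The gradient at `e` of the anchored piece `G^{(k)}_{e₀}` depends only on `linkBall (2(k+1)) e`: it
vanishes unless `e ∈ linkBall (k+1) e₀` (`linkDeriv_eq_zero_of_not_mem`), and in that case
`linkBall (k+1) e₀ ⊆ linkBall (2(k+1)) e` (symmetry and triangle inequality of the balls). [ours] -/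
theorem linkDeriv_anchTerm_mem_depOn (B : SuBasis n) (k : ℕ) (e₀ e : Edge d L)
    (X : Matrix (Fin n) (Fin n) ℂ) :
    linkDeriv e X (anchTerm B k e₀) ∈ depOn (linkBall (2 * (k + 1)) e) := by
  have hdep : anchTerm B k e₀ ∈ depOn (n := n) (linkBall (k + 1) e₀) :=
    (Submodule.mem_inf.1 (anchTerm_mem B k e₀)).2
  by_cases he : e ∈ linkBall (k + 1) e₀
  · have hsub : linkBall (k + 1) e₀ ⊆ linkBall (2 * (k + 1)) e := fun e' he' => by
      rw [two_mul]
      exact linkBall_add ((mem_linkBall_comm (k + 1) e₀ e).1 he) he'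
    exact depOn_mono hsub (linkDeriv_mem_depOn e X hdep)
  · rw [linkDeriv_eq_zero_of_not_mem X hdep he]
    exact const_mem_depOn _ 0

/-- **C2(a) — footprint of the order-`k` gradient (constructed series).** `∂_{e,X} S̃_W^{(k)}`, for the
tree's solution `S̃_W^{(k)} = wilsonSk d L B k = ∑_{e₀} G^{(k)}_{e₀}`, depends only on the link variables
in the plaquette ball of radius `2(k+1)` about `e` ("local terms whose footprint on the lattice increases
proportionally to the order k"). [cite: Luscher2010Trivializing, §4.5(b)] -/
theorem linkDeriv_wilsonSk_dependsOn (B : SuBasis n) (k : ℕ) (e : Edge d L)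
    (X : Matrix (Fin n) (Fin n) ℂ) :
    DependsOn (linkDeriv e X (wilsonSk d L B k)) (linkBall (2 * (k + 1)) e) := by
  have h := linkDeriv_finset_sum e X Finset.univ (fun e₀ : Edge d L => anchTerm B k e₀)
    (fun e₀ _ => contDiff_anchTerm B k e₀)
  rw [show wilsonSk d L B k = fun W => ∑ e₀ : Edge d L, anchTerm B k e₀ W from rfl, h]
  intro W W' hWW'
  exact Finset.sum_congr rfl fun e₀ _ => linkDeriv_anchTerm_mem_depOn B k e₀ e X hWW'

/-- Gradients on the field manifold of ANY smooth solution of the recursion for `β S_W` are those of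
`β^{k+1} S̃_W^{(k)}` (uniqueness of gradients `IsLuscherSeries.linkDeriv_eq` against the rescaled
constructed series `IsLuscherSeries.smul`). [ours] -/
theorem linkDeriv_series_eq_smul_wilsonSk (B : SuBasis n) (β : ℝ) {Sk : ℕ → AmbConfig d L n → ℝ}
    {c : ℕ → ℝ} (hsm : ∀ k, ContDiff ℝ ∞ (Sk k))
    (hser : IsLuscherSeries B (fun W => β * ambWilsonAction W) Sk c) (k : ℕ) (e : Edge d L) (a : B.ι)
    (U : GaugeConfig d L (Matrix.specialUnitaryGroup (Fin n) ℂ)) :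
    linkDeriv e (B.T a) (Sk k) (WilsonFlow.coeConfig U) =
      β ^ (k + 1) * linkDeriv e (B.T a) (wilsonSk d L B k) (WilsonFlow.coeConfig U) := by
  rw [(IsLuscherSeries.linkDeriv_eq hser ((isLuscherSeries_wilsonSk B).smul β) hsm
    (fun j => contDiff_const.mul (contDiff_wilsonSk B j)) k).2 e a U, linkDeriv_const_mul']

/-- **C2(a) — footprint of the order-`k` gradient, every solution.** For every smooth solution of
Lüscher's recursion for `β S_W` and all `U, U' ∈ SU(n)^E` that agree on `linkBall (2(k+1)) e`:
`∂^a_e S̃^{(k)}(ιU) = ∂^a_e S̃^{(k)}(ιU')`. [cite: Luscher2010Trivializing, §4.5(b)] -/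
theorem linkDeriv_series_local (B : SuBasis n) (β : ℝ) {Sk : ℕ → AmbConfig d L n → ℝ} {c : ℕ → ℝ}
    (hsm : ∀ k, ContDiff ℝ ∞ (Sk k)) (hser : IsLuscherSeries B (fun W => β * ambWilsonAction W) Sk c)
    (k : ℕ) (e : Edge d L) (a : B.ι) {U U' : GaugeConfig d L (Matrix.specialUnitaryGroup (Fin n) ℂ)}
    (hUU' : ∀ e' ∈ linkBall (2 * (k + 1)) e, U e' = U' e') :
    linkDeriv e (B.T a) (Sk k) (WilsonFlow.coeConfig U) =
      linkDeriv e (B.T a) (Sk k) (WilsonFlow.coeConfig U') := by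
  rw [linkDeriv_series_eq_smul_wilsonSk B β hsm hser k e a U,
    linkDeriv_series_eq_smul_wilsonSk B β hsm hser k e a U',
    linkDeriv_wilsonSk_dependsOn B k e (B.T a) (coeConfig_eqOn hUU')]

/-- `∂_{e,X}` of the truncated flow action: `∂ S̃^{[N]}_t = ∑_{k≤N} t^k ∂ S̃^{(k)}`. [folklore] -/
theorem linkDeriv_truncFlowAction {Sk : ℕ → AmbConfig d L n → ℝ} (hsm : ∀ k, ContDiff ℝ ∞ (Sk k))
    (t : ℝ) (N : ℕ) (e : Edge d L) (X : Matrix (Fin n) (Fin n) ℂ) (W : AmbConfig d L n) :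
    linkDeriv e X (truncFlowAction Sk t N) W =
      ∑ k ∈ Finset.range (N + 1), t ^ k * linkDeriv e X (Sk k) W := by
  have h := linkDeriv_finset_sum e X (Finset.range (N + 1)) (fun k W => t ^ k * Sk k W)
    (fun k _ => contDiff_const.mul (hsm k))
  calc linkDeriv e X (truncFlowAction Sk t N) W
      = ∑ k ∈ Finset.range (N + 1), linkDeriv e X (fun W => t ^ k * Sk k W) W := congrFun h W
    _ = ∑ k ∈ Finset.range (N + 1), t ^ k * linkDeriv e X (Sk k) W :=
        Finset.sum_congr rfl fun k _ => linkDeriv_const_mul' e X (t ^ k) (Sk k) W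

/-- **The order-`N` generator is strictly local, every solution.** For every smooth solution for `β S_W`,
every `t` and all `U, U' ∈ SU(n)^E` agreeing on `linkBall (2(N+1)) e`: `∂^a_e S̃^{[N]}_t(ιU) =
∂^a_e S̃^{[N]}_t(ιU')`. [cite: Luscher2010Trivializing, §4.5(b)] -/
theorem linkDeriv_truncFlowAction_local (B : SuBasis n) (β : ℝ) {Sk : ℕ → AmbConfig d L n → ℝ}
    {c : ℕ → ℝ} (hsm : ∀ k, ContDiff ℝ ∞ (Sk k))
    (hser : IsLuscherSeries B (fun W => β * ambWilsonAction W) Sk c) (t : ℝ) (N : ℕ) (e : Edge d L)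
    (a : B.ι) {U U' : GaugeConfig d L (Matrix.specialUnitaryGroup (Fin n) ℂ)}
    (hUU' : ∀ e' ∈ linkBall (2 * (N + 1)) e, U e' = U' e') :
    linkDeriv e (B.T a) (truncFlowAction Sk t N) (WilsonFlow.coeConfig U) =
      linkDeriv e (B.T a) (truncFlowAction Sk t N) (WilsonFlow.coeConfig U') := by
  rw [linkDeriv_truncFlowAction hsm, linkDeriv_truncFlowAction hsm]
  refine Finset.sum_congr rfl fun k hk => ?_
  have hk' : 2 * (k + 1) ≤ 2 * (N + 1) := by
    have := Finset.mem_range.1 hk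
    omega
  rw [linkDeriv_series_local B β hsm hser k e a fun e' he' => hUU' e' (linkBall_mono hk' e he')]

/-- **The generator field `-∂S̃^{[N]}_t` of the order-`N` analytic sampler is strictly local with radius
`2(N+1)`, every solution, every volume**: its value at the link `e` on `SU(n)^E` is unchanged when the
configuration is modified outside `linkBall (2(N+1)) e`. [cite: Luscher2010Trivializing, §4.2 eq. (4.4),
§4.5(b)] -/
theorem linkGrad_truncFlowAction_local (B : SuBasis n) (β : ℝ) {Sk : ℕ → AmbConfig d L n → ℝ}
    {c : ℕ → ℝ} (hsm : ∀ k, ContDiff ℝ ∞ (Sk k))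
    (hser : IsLuscherSeries B (fun W => β * ambWilsonAction W) Sk c) (t : ℝ) (N : ℕ) (e : Edge d L)
    {U U' : GaugeConfig d L (Matrix.specialUnitaryGroup (Fin n) ℂ)}
    (hUU' : ∀ e' ∈ linkBall (2 * (N + 1)) e, U e' = U' e') :
    linkGrad B (truncFlowAction Sk t N) (WilsonFlow.coeConfig U) e =
      linkGrad B (truncFlowAction Sk t N) (WilsonFlow.coeConfig U') e := by
  simp only [linkGrad]
  exact Finset.sum_congr rfl fun a _ => by
    rw [linkDeriv_truncFlowAction_local B β hsm hser t N e a hUU']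

end Footprint

/-! ## §3. Geometric control of every order at every coupling (Theorem A rescaled) -/

section Geometric

/-- **Theorem A at coupling `β` (ours; PROVED, unconditional).** There are `ρ = ρ(d,n) > 0` and
`C = C(d,n) ≥ 0` such that for every `β`, every lattice size `L`, every orthonormal basis of `𝔰𝔲(n)`,
every smooth solution `S̃^{(k)}` of Lüscher's recursion for `β S_W`, and all `k, U, e, a`:
`|∂^a_e S̃^{(k)}(ιU)| ≤ C |β|^{k+1} ρ^{-k}` (`GradedSeries.luscherGeometricGradientBound_holds` for `S_W`,
transported by `linkDeriv_series_eq_smul_wilsonSk`). [ours] -/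
theorem seriesGradient_geometric (d n : ℕ) : ∃ ρ : ℝ, 0 < ρ ∧ ∃ C : ℝ, 0 ≤ C ∧
    ∀ (β : ℝ) (L : ℕ) [NeZero L] (B : SuBasis n) (Sk : ℕ → AmbConfig d L n → ℝ) (c : ℕ → ℝ),
      (∀ k, ContDiff ℝ ∞ (Sk k)) → IsLuscherSeries B (fun W => β * ambWilsonAction W) Sk c →
      ∀ (k : ℕ) (U : GaugeConfig d L (Matrix.specialUnitaryGroup (Fin n) ℂ)) (e : Edge d L)
        (a : B.ι),
        |linkDeriv e (B.T a) (Sk k) (WilsonFlow.coeConfig U)| ≤ C * |β| ^ (k + 1) * ρ⁻¹ ^ k := by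
  obtain ⟨ρ, hρ, C, hC⟩ := GradedSeries.luscherGeometricGradientBound_holds d n
  refine ⟨ρ, hρ, max C 0, le_max_right _ _, fun β L _ B Sk c hsm hser k U e a => ?_⟩
  have hW : |linkDeriv e (B.T a) (wilsonSk d L B k) (WilsonFlow.coeConfig U)| ≤ max C 0 * ρ⁻¹ ^ k :=
    (hC L B (wilsonSk d L B) (wilsonConst d L B) (fun j => contDiff_wilsonSk B j)
      (isLuscherSeries_wilsonSk B) k U e a).trans
      (mul_le_mul_of_nonneg_right (le_max_left _ _) (pow_nonneg (inv_nonneg.2 hρ.le) _))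
  rw [linkDeriv_series_eq_smul_wilsonSk B β hsm hser k e a U, abs_mul, abs_pow]
  calc |β| ^ (k + 1) * |linkDeriv e (B.T a) (wilsonSk d L B k) (WilsonFlow.coeConfig U)|
      ≤ |β| ^ (k + 1) * (max C 0 * ρ⁻¹ ^ k) :=
        mul_le_mul_of_nonneg_left hW (pow_nonneg (abs_nonneg β) _)
    _ = max C 0 * |β| ^ (k + 1) * ρ⁻¹ ^ k := by ring

end Geometric

/-! ## §4. The generator series and its volume-uniform tail (C2(b), series side) -/

section Series

/-- Elementary geometric tails: if `|f k| ≤ M q^k` with `0 ≤ q < 1` then `f` is summable and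
`|∑' f - ∑_{k≤K} f k| ≤ M q^{K+1} / (1-q)`. [folklore] -/
theorem abs_tsum_sub_sum_le_of_geometric {f : ℕ → ℝ} {M q : ℝ} (hq0 : 0 ≤ q) (hq1 : q < 1)
    (h : ∀ k, |f k| ≤ M * q ^ k) (K : ℕ) :
    Summable f ∧
      |∑' k, f k - ∑ k ∈ Finset.range (K + 1), f k| ≤ M * q ^ (K + 1) / (1 - q) := by
  have hgeo : Summable fun k => M * q ^ k := (summable_geometric_of_lt_one hq0 hq1).mul_left M
  have habs : Summable fun k => |f k| := Summable.of_nonneg_of_le (fun k => abs_nonneg _) h hgeo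
  have hf : Summable f := habs.of_abs
  refine ⟨hf, ?_⟩
  have hF : Summable fun k => f (k + (K + 1)) := (summable_nat_add_iff (K + 1)).2 hf
  have hshift : Summable fun k => |f (k + (K + 1))| :=
    (summable_nat_add_iff (f := fun k => |f k|) (K + 1)).2 habs
  have hgeo' : Summable fun k => M * q ^ (k + (K + 1)) :=
    (summable_nat_add_iff (f := fun k => M * q ^ k) (K + 1)).2 hgeo
  rw [← hf.sum_add_tsum_nat_add (K + 1), add_sub_cancel_left]
  calc |∑' k, f (k + (K + 1))| ≤ ∑' k, |f (k + (K + 1))| := by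
        have h1 := norm_tsum_le_tsum_norm hF.norm
        simpa only [Real.norm_eq_abs] using h1
    _ ≤ ∑' k, M * q ^ (k + (K + 1)) := Summable.tsum_le_tsum (fun k => h _) hshift hgeo'
    _ = M * q ^ (K + 1) * ∑' k : ℕ, q ^ k := by
        rw [← tsum_mul_left]
        congr 1
        funext k
        ring
    _ = M * q ^ (K + 1) / (1 - q) := by rw [tsum_geometric_of_lt_one hq0 hq1, div_eq_mul_inv]

/-- **C2(b), series side — the generator series and its volume-uniform tail (ours; PROVED,
unconditional).** There are `ρ = ρ(d,n) > 0` and `C = C(d,n) ≥ 0` such that for every `0 < η ≤ 1`, all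
`β, t` with `|t|·|β| ≤ (1-η) ρ`, every lattice size `L`, basis, smooth solution `S̃^{(k)}` of Lüscher's
recursion for `β S_W`, and all `U ∈ SU(n)^E`, `e`, `a`, `K`: the generator series
`g_t(U)^a_e = ∑_k t^k ∂^a_e S̃^{(k)}(ιU)` converges absolutely and its order-`K` truncation (the generator
coefficient of the order-`K` analytic sampler, `linkDeriv_truncFlowAction`) is accurate to
`|g_t(U)^a_e - ∑_{k≤K} t^k ∂^a_e S̃^{(k)}(ιU)| ≤ C |β| (1-η)^{K+1} / η` — a bound in which `L` and `U` do
not occur. [cite: Luscher2010Trivializing, §4.5(b)] -/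
theorem generatorSeries_tail_le (d n : ℕ) : ∃ ρ : ℝ, 0 < ρ ∧ ∃ C : ℝ, 0 ≤ C ∧
    ∀ (η : ℝ), 0 < η → η ≤ 1 → ∀ (β t : ℝ), |t| * |β| ≤ (1 - η) * ρ →
    ∀ (L : ℕ) [NeZero L] (B : SuBasis n) (Sk : ℕ → AmbConfig d L n → ℝ) (c : ℕ → ℝ),
      (∀ k, ContDiff ℝ ∞ (Sk k)) → IsLuscherSeries B (fun W => β * ambWilsonAction W) Sk c →
      ∀ (U : GaugeConfig d L (Matrix.specialUnitaryGroup (Fin n) ℂ)) (e : Edge d L) (a : B.ι)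
        (K : ℕ),
        Summable (fun k => t ^ k * linkDeriv e (B.T a) (Sk k) (WilsonFlow.coeConfig U)) ∧
        |∑' k, t ^ k * linkDeriv e (B.T a) (Sk k) (WilsonFlow.coeConfig U) -
            ∑ k ∈ Finset.range (K + 1),
              t ^ k * linkDeriv e (B.T a) (Sk k) (WilsonFlow.coeConfig U)| ≤
          C * |β| * (1 - η) ^ (K + 1) / η := by
  obtain ⟨ρ, hρ, C, hC0, hC⟩ := seriesGradient_geometric d n
  refine ⟨ρ, hρ, C, hC0, fun η hη hη1 β t htβ L _ B Sk c hsm hser U e a K => ?_⟩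
  have hq0 : 0 ≤ 1 - η := sub_nonneg.2 hη1
  have hq1 : 1 - η < 1 := by linarith
  have hratio : |t| * |β| * ρ⁻¹ ≤ 1 - η := by
    rw [← div_eq_mul_inv, div_le_iff₀ hρ]
    exact htβ
  have hterm : ∀ k, |t ^ k * linkDeriv e (B.T a) (Sk k) (WilsonFlow.coeConfig U)| ≤
      C * |β| * (1 - η) ^ k := by
    intro k
    rw [abs_mul, abs_pow]
    calc |t| ^ k * |linkDeriv e (B.T a) (Sk k) (WilsonFlow.coeConfig U)|
        ≤ |t| ^ k * (C * |β| ^ (k + 1) * ρ⁻¹ ^ k) :=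
          mul_le_mul_of_nonneg_left (hC β L B Sk c hsm hser k U e a) (pow_nonneg (abs_nonneg t) _)
      _ = C * |β| * (|t| * |β| * ρ⁻¹) ^ k := by rw [mul_pow, mul_pow, pow_succ]; ring
      _ ≤ C * |β| * (1 - η) ^ k :=
          mul_le_mul_of_nonneg_left (pow_le_pow_left₀
            (mul_nonneg (mul_nonneg (abs_nonneg t) (abs_nonneg β)) (inv_nonneg.2 hρ.le)) hratio k)
            (mul_nonneg hC0 (abs_nonneg β))
  have h := abs_tsum_sub_sum_le_of_geometric hq0 hq1 hterm K
  refine ⟨h.1, h.2.trans_eq ?_⟩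
  rw [sub_sub_cancel]

/-- **The generator series does not depend on the solution of the recursion** (all smooth solutions
have the same gradients on the field manifold, `IsLuscherSeries.linkDeriv_eq`). [ours] -/
theorem generatorSeries_eq_of_isLuscherSeries [NeZero L] (B : SuBasis n) {S : AmbConfig d L n → ℝ}
    {Sk Sk' : ℕ → AmbConfig d L n → ℝ} {c c' : ℕ → ℝ} (hser : IsLuscherSeries B S Sk c)
    (hser' : IsLuscherSeries B S Sk' c') (hsm : ∀ k, ContDiff ℝ ∞ (Sk k))
    (hsm' : ∀ k, ContDiff ℝ ∞ (Sk' k)) (t : ℝ)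
    (U : GaugeConfig d L (Matrix.specialUnitaryGroup (Fin n) ℂ)) (e : Edge d L) (a : B.ι) :
    ∑' k, t ^ k * linkDeriv e (B.T a) (Sk k) (WilsonFlow.coeConfig U) =
      ∑' k, t ^ k * linkDeriv e (B.T a) (Sk' k) (WilsonFlow.coeConfig U) :=
  tsum_congr fun k => by rw [(IsLuscherSeries.linkDeriv_eq hser hser' hsm hsm' k).2 e a U]

end Series

/-! ## §5. Exponential locality of the generator series, uniformly in the volume (C2) -/

section Locality

/-- Two reals each within `b` of a common value are within `2b` of each other. [folklore] -/
theorem abs_sub_le_two_mul_of_near {x y p b : ℝ} (hx : |x - p| ≤ b) (hy : |y - p| ≤ b) :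
    |x - y| ≤ 2 * b := by
  calc |x - y| ≤ |x - p| + |p - y| := abs_sub_le x p y
    _ ≤ b + b := add_le_add hx (by rwa [abs_sub_comm])
    _ = 2 * b := by ring

/-- **C2 — the trivializing-flow generator series is exponentially local, uniformly in the volume (ours;
PROVED, unconditional).**  There are `ρ = ρ(d,n) > 0` and `C = C(d,n) ≥ 0` such that for every
`0 < η ≤ 1`, all `β, t` with `|t|·|β| ≤ (1-η) ρ`, EVERY lattice size `L`, every basis, every smooth
solution `S̃^{(k)}` of Lüscher's recursion (4.12)–(4.13) for `β S_W`, every `K`, link `e`, colour `a`, and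
all `U, U' ∈ SU(n)^E` that AGREE ON THE PLAQUETTE BALL `linkBall (2(K+1)) e`:
`|g_t(U)^a_e - g_t(U')^a_e| ≤ 2 C |β| (1-η)^{K+1} / η`, `g_t(U)^a_e = ∑_k t^k ∂^a_e S̃^{(k)}(ιU)`.
(The truncations at order `K` coincide by §2; each tail is bounded by §4.)  Lüscher §4.5(b) asserts the
locality of the flow action "at the values of t, where the expansion converges"; here the convergence AND
the locality modulus hold with constants independent of `L`. [cite: Luscher2010Trivializing, §4.5(b)] -/
theorem generatorSeries_exponentially_local (d n : ℕ) : ∃ ρ : ℝ, 0 < ρ ∧ ∃ C : ℝ, 0 ≤ C ∧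
    ∀ (η : ℝ), 0 < η → η ≤ 1 → ∀ (β t : ℝ), |t| * |β| ≤ (1 - η) * ρ →
    ∀ (L : ℕ) [NeZero L] (B : SuBasis n) (Sk : ℕ → AmbConfig d L n → ℝ) (c : ℕ → ℝ),
      (∀ k, ContDiff ℝ ∞ (Sk k)) → IsLuscherSeries B (fun W => β * ambWilsonAction W) Sk c →
      ∀ (K : ℕ) (e : Edge d L) (a : B.ι)
        (U U' : GaugeConfig d L (Matrix.specialUnitaryGroup (Fin n) ℂ)),
        (∀ e' ∈ linkBall (2 * (K + 1)) e, U e' = U' e') →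
        |∑' k, t ^ k * linkDeriv e (B.T a) (Sk k) (WilsonFlow.coeConfig U) -
            ∑' k, t ^ k * linkDeriv e (B.T a) (Sk k) (WilsonFlow.coeConfig U')| ≤
          2 * (C * |β| * (1 - η) ^ (K + 1) / η) := by
  obtain ⟨ρ, hρ, C, hC0, h⟩ := generatorSeries_tail_le d n
  refine ⟨ρ, hρ, C, hC0, fun η hη hη1 β t htβ L _ B Sk c hsm hser K e a U U' hUU' => ?_⟩
  obtain ⟨-, hU⟩ := h η hη hη1 β t htβ L B Sk c hsm hser U e a K
  obtain ⟨-, hU'⟩ := h η hη hη1 β t htβ L B Sk c hsm hser U' e a K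
  have hpart :
      ∑ k ∈ Finset.range (K + 1), t ^ k * linkDeriv e (B.T a) (Sk k) (WilsonFlow.coeConfig U) =
        ∑ k ∈ Finset.range (K + 1),
          t ^ k * linkDeriv e (B.T a) (Sk k) (WilsonFlow.coeConfig U') := by
    refine Finset.sum_congr rfl fun k hk => ?_
    have hk' : 2 * (k + 1) ≤ 2 * (K + 1) := by
      have := Finset.mem_range.1 hk
      omega
    rw [linkDeriv_series_local B β hsm hser k e a fun e' he' => hUU' e' (linkBall_mono hk' e he')]
  rw [← hpart] at hU'
  exact abs_sub_le_two_mul_of_near hU hU'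

/-- **C2 on the whole flow interval.** For `|β| ≤ (1-η) ρ` the locality bound of
`generatorSeries_exponentially_local` holds for every flow time `t ∈ [-1, 1]` — in particular at the
trivializing time `t = 1`. [cite: Luscher2010Trivializing, §4.5(b)] -/
theorem generatorSeries_exponentially_local_unit_time (d n : ℕ) : ∃ ρ : ℝ, 0 < ρ ∧ ∃ C : ℝ, 0 ≤ C ∧
    ∀ (η : ℝ), 0 < η → η ≤ 1 → ∀ (β : ℝ), |β| ≤ (1 - η) * ρ → ∀ (t : ℝ), |t| ≤ 1 →
    ∀ (L : ℕ) [NeZero L] (B : SuBasis n) (Sk : ℕ → AmbConfig d L n → ℝ) (c : ℕ → ℝ),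
      (∀ k, ContDiff ℝ ∞ (Sk k)) → IsLuscherSeries B (fun W => β * ambWilsonAction W) Sk c →
      ∀ (K : ℕ) (e : Edge d L) (a : B.ι)
        (U U' : GaugeConfig d L (Matrix.specialUnitaryGroup (Fin n) ℂ)),
        (∀ e' ∈ linkBall (2 * (K + 1)) e, U e' = U' e') →
        |∑' k, t ^ k * linkDeriv e (B.T a) (Sk k) (WilsonFlow.coeConfig U) -
            ∑' k, t ^ k * linkDeriv e (B.T a) (Sk k) (WilsonFlow.coeConfig U')| ≤
          2 * (C * |β| * (1 - η) ^ (K + 1) / η) := by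
  obtain ⟨ρ, hρ, C, hC0, h⟩ := generatorSeries_exponentially_local d n
  refine ⟨ρ, hρ, C, hC0, fun η hη hη1 β hβ t ht L _ B Sk c hsm hser K e a U U' hUU' => ?_⟩
  have htβ : |t| * |β| ≤ (1 - η) * ρ :=
    (mul_le_of_le_one_left (abs_nonneg β) ht).trans hβ
  exact h η hη hη1 β t htβ L B Sk c hsm hser K e a U U' hUU'

end Locality

end Summit.Ventures.LatticeQCDFlow.TrivializingMaps
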